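import Summits.Ventures.LatticeQCDFlow.Exactness.Phi4FlowSquareIntegrableAcceptanceCeiling
import Summits.Ventures.LatticeQCDFlow.Scoring.SelfNormalisedReweightingCLT
import HarnessLib

/-!
# The flow arm's reweighting estimator on the lattice: its CLT variance is `σ²_RW(f) = Z⁻²∫(f − ⟨f⟩)² b e^{−S}`,
# and the exact chain's variance is pinned above it: `σ²_chain ≤ (2/ā)(σ²_RW + Var/κ) − Var`

HONEST FRAMING: exact (Metropolis-corrected) sampling algorithms for lattice gauge theory;
figures of merit are autocorrelation/cost numbers at stated couplings and volumes; no
continuum-physics claim.  (SCALAR calibration rung S0-A: not a gauge result.)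

Venture `LatticeQCDFlow` (cell pub-lqcd), topic `Exactness`; FANOUT row 2 (`s0-phi4`, FLOW arm).
NEW WORK of the cell (instantiation and repackaging of tree theorems; nothing is cited as a fact;
no definition).  Two published uses of one trained flow `q̃` against `e^{−S}`: the exact chain
`imhOpPhi4 J λ q̃` (accept/reject) and self-normalised REWEIGHTING of independent draws
`φ₁, φ₂, … ∼ q̃` with the computable weights `b = e^{−S}/q̃`,
`R_N(f) = Σ_{i<N} b(φᵢ) f(φᵢ) / Σ_{i<N} b(φᵢ)`.  This file types, for the lattice objects of row 2:
(1) the reweighting CLT — row 4's `Scoring.CardConsistency.selfNormReweighting_clt` (Mathlib's CLT +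
Slutsky, normalised target density) instantiated with `p = e^{−S}/Z`, unnormalised weights `b`
(`c = Z`): `√N (R_N(f) − ⟨f⟩) ⇒ N(0, σ²_RW(f))`, **`σ²_RW(f) = Z⁻² ∫ (f − ⟨f⟩)² b e^{−S} dφ`** — the
quantity that the companion file `FlowSamplerVsReweighting` (same session) bounds by the chain's
`σ²_chain(f) = 2 τ_int(f) Var(f)` from above; (2) the other side of the pinning, the tree's
acceptance/ESS ceiling in i.i.d.-estimable form (`Phi4FlowSquareIntegrableAcceptanceCeiling`,
Deligiannidis–Lee's upper bound NAMED there) rewritten in the same variance units: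
**`σ²_chain(f) ≤ (2/ā)(σ²_RW(f) + Var(f)/κ) − Var(f)`**, `κ = Z²/W₂` the flow's Kish fraction,
`ā` the equilibrium acceptance.  Together (with the companion's floor): for every observable the
exact chain's large-`N` error bar per draw lies between the reweighting error bar and
`√((2/ā)(σ²_RW + Var/κ) − Var)` — both ends are averages over INDEPENDENT flow draws.

## What is proved

General space (`(X, μ)` s-finite; `w, q > 0` measurable integrable, `∫ q = 1`, `Z = ∫ w`, `b = w/q`,
`W₂ = ∫ b w < ∞`; `m = (∫ f w)/Z`):
* `integrable_weightMoments_of_centredMoment` — `(f − m)² b w ∈ L¹` and `f w ∈ L¹` give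
  `b w f, b w f² ∈ L¹`;
* **`flow_reweighting_clt`** — along ANY i.i.d. stream `y₀, y₁, …` of law `q dμ` (on any probability
  space), for every measurable `f` with `f w ∈ L¹` and `(f − m)² b w ∈ L¹`:
  `√N (Σ_{i<N} b(yᵢ) f(yᵢ) / Σ_{i<N} b(yᵢ) − m) ⇒ Y` in distribution for any `Y ∼ N(0, Z⁻²∫(f − m)² b w)`;
* **`imhOp_chainVar_le_of_reweightVar_of_sq`** — for centred square-integrable `g` with
  `∫ g² w > 0` and `g² b w ∈ L¹`: `2 τ_int(g) (∫g²w)/Z ≤ (2/ā)((∫ g² b w)/Z² + ((∫g²w)/Z)(W₂/Z²)) − (∫g²w)/Z`.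
Lattice φ⁴ (`Λ = Fin (n+1)`, every `λ > 0`, real `J`, EVERY positive model density `q̃`, `∫ q̃ = 1`,
`W₂ = ∫ e^{−S} b < ∞`):
* **`phi4Flow_reweighting_clt_bdd`** (bounded measurable `f`), **`phi4Flow_reweighting_clt_poly`**
  (`f ∈ PolyObs` with `(f − ⟨f⟩)² b e^{−S} ∈ L¹`): `√N (R_N(f) − ⟨f⟩) ⇒ N(0, σ²_RW(f))`;
* **`phi4Flow_chainVar_le_of_reweightVar_poly`** — `f ∈ PolyObs`, `Var f > 0`,
  `(f − ⟨f⟩)² b e^{−S} ∈ L¹`: `2 τ_int(f) Var(f) ≤ (2/ā)(σ²_RW(f) + Var(f)·W₂/Z²) − Var(f)`.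

Reading for S0-A (no numerics implied): the honest large-`N` error bar of a reweighted observable
from the flow's independent draws is `√(σ²_RW(f)/N)` with `σ²_RW` as above — NOT `√(Var/(N·ESS))`
(row 13's remark, now typed for the lattice flow arm); and the exact chain's error bar on the same
number of draws is never smaller (companion file) and at most `√(((2/ā)(σ²_RW + Var/κ) − Var)/N)`.
NOT CLAIMED: any value of `σ²_RW`, `ā`, `κ`, `τ_int` for any network or run; Berry–Esseen rates or
finite-`N` coverage (row 4's median-of-blocks files); the reweighting estimator's `O(1/N)` bias;
cost accounting beyond "per model draw"; anything for the HMC / local arms.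
-/

namespace Summit.Ventures.LatticeQCDFlow.Exactness

open Real MeasureTheory ProbabilityTheory Filter Finset Set Topology
open Summit.Ventures.LatticeQCDFlow.Scoring
open Summit.Ventures.LatticeQCDFlow.Scoring.CardConsistency

/-! ## §1 General space: the reweighting CLT with unnormalised weights `b = w/q` -/

section General

variable {X : Type*} [MeasurableSpace X] {μ : Measure X} {w q : X → ℝ}

/-- Pointwise: `b w |f| ≤ b w (1 + f²)` and `b w f² ≤ 2 b w (f − m)² + 2 m² b w`
packaged as integrability: `(f − m)² b w, b w ∈ L¹ ⇒ b w f, b w f² ∈ L¹`. -/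
theorem integrable_weightMoments_of_centredMoment (hw0 : ∀ t, 0 < w t)
    (hwm : Measurable w) (hq0 : ∀ t, 0 < q t) (hqm : Measurable q)
    (hW₂ : Integrable (fun x => w x / q x * w x) μ) {f : X → ℝ} (hfm : Measurable f) (m : ℝ)
    (hfb : Integrable (fun x => (f x - m) ^ 2 * (w x / q x * w x)) μ) :
    Integrable (fun x => w x / q x * w x * f x) μ ∧
    Integrable (fun x => w x / q x * w x * f x ^ 2) μ := by
  have hb0 : ∀ x, 0 ≤ w x / q x * w x := fun x =>
    mul_nonneg (div_pos (hw0 x) (hq0 x)).le (hw0 x).le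
  have hbm : Measurable fun x => w x / q x * w x := (hwm.div hqm).mul hwm
  have h2 : Integrable (fun x => w x / q x * w x * f x ^ 2) μ := by
    refine Integrable.mono' ((hfb.const_mul 2).add (hW₂.const_mul (2 * m ^ 2)))
      (hbm.mul (hfm.pow_const 2)).aestronglyMeasurable (Eventually.of_forall fun x => ?_)
    rw [Real.norm_eq_abs, abs_of_nonneg (mul_nonneg (hb0 x) (sq_nonneg _))]
    have e : f x ^ 2 ≤ 2 * (f x - m) ^ 2 + 2 * m ^ 2 := by nlinarith [sq_nonneg (f x - 2 * m)]
    have := mul_le_mul_of_nonneg_left e (hb0 x)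
    simp only [Pi.add_apply]
    nlinarith [this, hb0 x]
  refine ⟨?_, h2⟩
  refine Integrable.mono' (hW₂.add h2) (hbm.mul hfm).aestronglyMeasurable
    (Eventually.of_forall fun x => ?_)
  rw [Real.norm_eq_abs, abs_mul, abs_of_nonneg (hb0 x)]
  simp only [Pi.add_apply]
  have e : |f x| ≤ 1 + f x ^ 2 := by
    rcases le_total 0 (f x) with h | h
    · rw [abs_of_nonneg h]; nlinarith [sq_nonneg (f x - 1)]
    · rw [abs_of_nonpos h]; nlinarith [sq_nonneg (f x + 1)]
  nlinarith [mul_le_mul_of_nonneg_left e (hb0 x), hb0 x]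

/-- **THE REWEIGHTING CLT WITH UNNORMALISED WEIGHTS.**  `w, q > 0` measurable integrable, `∫ q = 1`,
`Z = ∫ w`, `b = w/q`, `W₂ = ∫ b w < ∞`; `f` measurable with `f w ∈ L¹` and `(f − m)² b w ∈ L¹`,
`m = (∫ f w)/Z` the target mean.  Along any i.i.d. stream `y` of law `q dμ`:
`√N (Σ_{i<N} b(yᵢ) f(yᵢ) / Σ_{i<N} b(yᵢ) − m) ⇒ Y` for any `Y ∼ N(0, Z⁻² ∫ (f − m)² b w dμ)`
(row 4's `selfNormReweighting_clt` with `p = w/Z`, `c = Z`). -/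
theorem flow_reweighting_clt (hw0 : ∀ t, 0 < w t) (hwm : Measurable w) (hwi : Integrable w μ)
    (hq0 : ∀ t, 0 < q t) (hqm : Measurable q) (hq1 : ∫ z, q z ∂μ = 1)
    (hW₂ : Integrable (fun x => w x / q x * w x) μ) {f : X → ℝ} (hfm : Measurable f)
    (hfw : Integrable (fun x => f x * w x) μ)
    (hfb : Integrable (fun x => (f x - (∫ z, f z * w z ∂μ) / ∫ z, w z ∂μ) ^ 2
      * (w x / q x * w x)) μ)
    {Ω : Type*} [MeasurableSpace Ω] {P : Measure Ω} [IsProbabilityMeasure P] {y : ℕ → Ω → X}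
    (hym : ∀ j, Measurable (y j)) (hind : iIndepFun y P)
    (hlaw : ∀ j, Measure.map (y j) P = μ.withDensity fun z => ENNReal.ofReal (q z))
    {Ω' : Type*} [MeasurableSpace Ω'] {P' : Measure Ω'} [IsProbabilityMeasure P'] {Yg : Ω' → ℝ}
    (hY : HasLaw Yg (gaussianReal 0
      ((∫ x, (f x - (∫ z, f z * w z ∂μ) / ∫ z, w z ∂μ) ^ 2 * (w x / q x * w x) ∂μ)
        / (∫ z, w z ∂μ) ^ 2).toNNReal) P') :
    TendstoInDistribution (fun (N : ℕ) ω => Real.sqrt N *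
        ((∑ i ∈ range N, w (y i ω) / q (y i ω) * f (y i ω))
          / (∑ i ∈ range N, w (y i ω) / q (y i ω)) - (∫ z, f z * w z ∂μ) / ∫ z, w z ∂μ))
      atTop Yg (fun _ => P) P' := by
  set Z : ℝ := ∫ z, w z ∂μ with hZdef
  have hZ : 0 < Z := integral_pos_of_pos hw0 hwi hq1
  set m : ℝ := (∫ z, f z * w z ∂μ) / Z with hmdef
  set p : X → ℝ := fun x => w x / Z with hpdef
  have hpm : Measurable p := hwm.div_const Z
  have hpi : Integrable p μ := hwi.div_const Z
  have hp1 : ∫ z, p z ∂μ = 1 := by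
    simp only [hpdef, integral_div]
    exact div_self hZ.ne'
  have hpO : Integrable (fun z => p z * f z) μ :=
    (hfw.div_const Z).congr (Eventually.of_forall fun z => by simp only [hpdef]; ring)
  have ha : ∫ x, p x * f x ∂μ = m := by
    have e : (fun x => p x * f x) = fun x => f x * w x / Z := funext fun x => by
      simp only [hpdef]; ring
    rw [e, integral_div]
  obtain ⟨hT1, hT2⟩ := integrable_weightMoments_of_centredMoment (μ := μ) hw0 hwm hq0 hqm hW₂ hfm m hfb
  have hM2i : Integrable (fun z => p z ^ 2 / q z) μ :=
    (hW₂.div_const (Z ^ 2)).congr (Eventually.of_forall fun z => by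
      simp only [hpdef]; field_simp)
  have hT1i : Integrable (fun z => p z ^ 2 / q z * f z) μ :=
    (hT1.div_const (Z ^ 2)).congr (Eventually.of_forall fun z => by
      simp only [hpdef]; field_simp)
  have hT2i : Integrable (fun z => p z ^ 2 / q z * f z ^ 2) μ :=
    (hT2.div_const (Z ^ 2)).congr (Eventually.of_forall fun z => by
      simp only [hpdef]; field_simp)
  have hwt : ∀ z, w z / q z = Z * (p z / q z) := fun z => by
    simp only [hpdef]; field_simp
  have hvar : ∫ z, p z ^ 2 / q z * (f z - ∫ x, p x * f x ∂μ) ^ 2 ∂μ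
      = (∫ x, (f x - m) ^ 2 * (w x / q x * w x) ∂μ) / Z ^ 2 := by
    rw [ha, ← integral_div]
    refine integral_congr_ae (Eventually.of_forall fun z => ?_)
    simp only [hpdef]
    field_simp
  have hY' : HasLaw Yg (gaussianReal 0
      (∫ z, p z ^ 2 / q z * (f z - ∫ x, p x * f x ∂μ) ^ 2 ∂μ).toNNReal) P' := by
    rw [hvar]; exact hY
  have h := selfNormReweighting_clt (μ := μ) (p := p) (q := q) (O := f) hym hind hlaw hpm hpi hp1
    hq0 hqm hfm hpO hM2i hT1i hT2i (wt := fun z => w z / q z) (c := Z) hZ.ne' hwt hY'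
  rw [ha] at h
  exact h

variable [SFinite μ]

/-- **THE UPPER PINNING IN VARIANCE UNITS** (the tree's i.i.d.-estimable acceptance/ESS ceiling,
rewritten): for centred square-integrable `g` with `∫ g² w > 0`, `W₂ < ∞`, `g² b w ∈ L¹`:
`2 τ_int(g) (∫ g² w)/Z ≤ (2/ā) ((∫ g² b w)/Z² + ((∫ g² w)/Z)(W₂/Z²)) − (∫ g² w)/Z`, i.e.
`σ²_chain ≤ (2/ā)(σ²_RW + Var/κ) − Var` with `ā = (∫ ρ w)/Z`, `κ = Z²/W₂`. -/
theorem imhOp_chainVar_le_of_reweightVar_of_sq (hw0 : ∀ t, 0 < w t) (hwm : Measurable w)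
    (hwi : Integrable w μ) (hq0 : ∀ t, 0 < q t) (hqm : Measurable q) (hqi : Integrable q μ)
    (hq1 : ∫ z, q z ∂μ = 1) (hW₂ : Integrable (fun x => w x / q x * w x) μ) {g : X → ℝ}
    (hgm : Measurable g) (hg2 : Integrable (fun t => g t ^ 2 * w t) μ) (hg0 : ∫ t, g t * w t ∂μ = 0)
    (hP : 0 < ∫ t, g t ^ 2 * w t ∂μ) (hgb : Integrable (fun t => g t ^ 2 * (w t / q t) * w t) μ) :
    2 * tauInt (fun n => (∫ t, g t * ((imhOp μ w q)^[n] g) t * w t ∂μ) / ∫ t, g t ^ 2 * w t ∂μ)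
        * ((∫ t, g t ^ 2 * w t ∂μ) / ∫ z, w z ∂μ)
      ≤ 2 / ((∫ t, (1 - rejCurve μ w q (w t / q t)) * w t ∂μ) / ∫ z, w z ∂μ)
          * ((∫ t, g t ^ 2 * (w t / q t) * w t ∂μ) / (∫ z, w z ∂μ) ^ 2
            + (∫ t, g t ^ 2 * w t ∂μ) / (∫ z, w z ∂μ)
              * ((∫ z, w z / q z * w z ∂μ) / (∫ z, w z ∂μ) ^ 2))
        - (∫ t, g t ^ 2 * w t ∂μ) / ∫ z, w z ∂μ := by
  have h := imhOp_tauInt_le_acceptanceESS_of_sq hw0 hwm hwi hq0 hqm hqi hq1 hW₂ hgm hg2 hg0 hP hgb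
  set A : ℝ := ∫ t, g t ^ 2 * w t ∂μ with hAdef
  set Z : ℝ := ∫ z, w z ∂μ with hZdef
  set W : ℝ := ∫ z, w z / q z * w z ∂μ with hWdef
  set Pρ : ℝ := ∫ t, (1 - rejCurve μ w q (w t / q t)) * w t ∂μ with hPρdef
  set Gb : ℝ := ∫ t, g t ^ 2 * (w t / q t) * w t ∂μ with hGb
  set τ := tauInt (fun n => (∫ t, g t * ((imhOp μ w q)^[n] g) t * w t ∂μ) / A) with hτ
  have hZ : 0 < Z := integral_pos_of_pos hw0 hwi hq1
  have hPρ : 0 < Pρ := (acc_mul_weight_integral_pos hw0 hwm hwi hq0 hqm hqi hq1).2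
  have hAZ : 0 < A / Z := div_pos hP hZ
  have h2 := mul_le_mul_of_nonneg_right h (le_of_lt (mul_pos two_pos hAZ))
  have e : ((W / Z ^ 2 + Gb / (Z * A)) / (Pρ / Z) - 1 / 2) * (2 * (A / Z))
      = 2 / (Pρ / Z) * (Gb / Z ^ 2 + A / Z * (W / Z ^ 2)) - A / Z := by
    field_simp
    ring
  rw [e] at h2
  linarith

end General

/-! ## §2 Lattice φ⁴: the reweighting CLT for the flow arm and the upper pinning -/

section Lattice

variable {n : ℕ}

/-- `gibbsExpect J λ f = (∫ f e^{−S}) / ∫ e^{−S}` (the tree's definition, `gibbsZ` unfolded). -/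
theorem gibbsExpect_eq_div_integral {lam : ℝ} (J : Fin (n + 1) → Fin (n + 1) → ℝ)
    (f : (Fin (n + 1) → ℝ) → ℝ) :
    gibbsExpect J lam f = (∫ φ, f φ * gibbsWeight J lam φ) / ∫ φ, gibbsWeight J lam φ := rfl

/-- **THE REWEIGHTING CLT FOR THE FLOW ARM OF LATTICE φ⁴, BOUNDED OBSERVABLES** (`λ > 0`, real `J`,
EVERY positive flow density `q̃` with `∫ q̃ = 1` and `W₂ = ∫ e^{−S} (e^{−S}/q̃) < ∞`): for every bounded
measurable `f`, along any i.i.d. stream `φ₀, φ₁, …` of flow draws,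
`√N (Σ_{i<N} b(φᵢ) f(φᵢ) / Σ_{i<N} b(φᵢ) − ⟨f⟩) ⇒ N(0, Z⁻² ∫ (f − ⟨f⟩)² b e^{−S})`, `b = e^{−S}/q̃`. -/
theorem phi4Flow_reweighting_clt_bdd {lam : ℝ} (hlam : 0 < lam)
    (J : Fin (n + 1) → Fin (n + 1) → ℝ) {q : (Fin (n + 1) → ℝ) → ℝ} (hq0 : ∀ φ, 0 < q φ)
    (hqm : Measurable q) (hq1 : ∫ φ, q φ = 1)
    (hW₂ : Integrable (fun φ => gibbsWeight J lam φ / q φ * gibbsWeight J lam φ))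
    {f : (Fin (n + 1) → ℝ) → ℝ} (hfm : Measurable f) {B : ℝ} (hfb : ∀ φ, |f φ| ≤ B)
    {Ω : Type*} [MeasurableSpace Ω] {P : Measure Ω} [IsProbabilityMeasure P]
    {y : ℕ → Ω → (Fin (n + 1) → ℝ)} (hym : ∀ j, Measurable (y j)) (hind : iIndepFun y P)
    (hlaw : ∀ j, Measure.map (y j) P = volume.withDensity fun φ => ENNReal.ofReal (q φ))
    {Ω' : Type*} [MeasurableSpace Ω'] {P' : Measure Ω'} [IsProbabilityMeasure P'] {Yg : Ω' → ℝ}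
    (hY : HasLaw Yg (gaussianReal 0
      ((∫ φ, (f φ - gibbsExpect J lam f) ^ 2 * (gibbsWeight J lam φ / q φ * gibbsWeight J lam φ))
        / gibbsZ J lam ^ 2).toNNReal) P') :
    TendstoInDistribution (fun (N : ℕ) ω => Real.sqrt N *
        ((∑ i ∈ range N, gibbsWeight J lam (y i ω) / q (y i ω) * f (y i ω))
          / (∑ i ∈ range N, gibbsWeight J lam (y i ω) / q (y i ω)) - gibbsExpect J lam f))
      atTop Yg (fun _ => P) P' := by
  have hw0 : ∀ φ, 0 < gibbsWeight J lam φ := fun φ => gibbsWeight_pos J lam φ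
  have hwm : Measurable (gibbsWeight J lam) := (continuous_gibbsWeight J lam).measurable
  have hwi : Integrable (gibbsWeight J lam) := integrable_gibbsWeight hlam J
  have hfw : Integrable (fun φ => f φ * gibbsWeight J lam φ) := by
    refine Integrable.mono' (hwi.const_mul B) (hfm.mul hwm).aestronglyMeasurable
      (Eventually.of_forall fun φ => ?_)
    rw [Real.norm_eq_abs, abs_mul, abs_of_pos (hw0 φ)]
    exact mul_le_mul_of_nonneg_right (hfb φ) (hw0 φ).le
  have hfbi : Integrable (fun φ => (f φ - gibbsExpect J lam f) ^ 2
      * (gibbsWeight J lam φ / q φ * gibbsWeight J lam φ)) := by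
    obtain ⟨hgm, hgb, -⟩ := centred_observable hlam J hfm hfb
    refine Integrable.mono' (hW₂.const_mul ((B + |gibbsExpect J lam f|) ^ 2))
      ((hgm.pow_const 2).mul ((hwm.div hqm).mul hwm)).aestronglyMeasurable
      (Eventually.of_forall fun φ => ?_)
    have hb0 : 0 ≤ gibbsWeight J lam φ / q φ * gibbsWeight J lam φ :=
      mul_nonneg (div_pos (hw0 φ) (hq0 φ)).le (hw0 φ).le
    rw [Real.norm_eq_abs, abs_of_nonneg (mul_nonneg (sq_nonneg _) hb0)]
    refine mul_le_mul_of_nonneg_right ?_ hb0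
    rw [← sq_abs]
    exact pow_le_pow_left₀ (abs_nonneg _) (hgb φ) 2
  have h := flow_reweighting_clt (μ := volume) hw0 hwm hwi hq0 hqm hq1 hW₂ hfm hfw
    (by rw [← gibbsExpect_eq_div_integral]; exact hfbi) hym hind hlaw
    (Yg := Yg) (P' := P') (by rw [← gibbsExpect_eq_div_integral]; exact hY)
  rw [← gibbsExpect_eq_div_integral] at h
  exact h

/-- **THE REWEIGHTING CLT FOR THE FLOW ARM OF LATTICE φ⁴, POLYNOMIAL OBSERVABLES**: for every
`f ∈ PolyObs` (magnetisation, `M²`, energy, …) with `(f − ⟨f⟩)² b e^{−S} ∈ L¹` and `W₂ < ∞`: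
`√N (R_N(f) − ⟨f⟩) ⇒ N(0, σ²_RW(f))`, `σ²_RW(f) = Z⁻² ∫ (f − ⟨f⟩)² b e^{−S}`. -/
theorem phi4Flow_reweighting_clt_poly {lam : ℝ} (hlam : 0 < lam)
    (J : Fin (n + 1) → Fin (n + 1) → ℝ) {q : (Fin (n + 1) → ℝ) → ℝ} (hq0 : ∀ φ, 0 < q φ)
    (hqm : Measurable q) (hq1 : ∫ φ, q φ = 1)
    (hW₂ : Integrable (fun φ => gibbsWeight J lam φ / q φ * gibbsWeight J lam φ))
    {f : (Fin (n + 1) → ℝ) → ℝ} (hf : PolyObs f)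
    (hfb : Integrable (fun φ => (f φ - gibbsExpect J lam f) ^ 2
      * (gibbsWeight J lam φ / q φ * gibbsWeight J lam φ)))
    {Ω : Type*} [MeasurableSpace Ω] {P : Measure Ω} [IsProbabilityMeasure P]
    {y : ℕ → Ω → (Fin (n + 1) → ℝ)} (hym : ∀ j, Measurable (y j)) (hind : iIndepFun y P)
    (hlaw : ∀ j, Measure.map (y j) P = volume.withDensity fun φ => ENNReal.ofReal (q φ))
    {Ω' : Type*} [MeasurableSpace Ω'] {P' : Measure Ω'} [IsProbabilityMeasure P'] {Yg : Ω' → ℝ}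
    (hY : HasLaw Yg (gaussianReal 0
      ((∫ φ, (f φ - gibbsExpect J lam f) ^ 2 * (gibbsWeight J lam φ / q φ * gibbsWeight J lam φ))
        / gibbsZ J lam ^ 2).toNNReal) P') :
    TendstoInDistribution (fun (N : ℕ) ω => Real.sqrt N *
        ((∑ i ∈ range N, gibbsWeight J lam (y i ω) / q (y i ω) * f (y i ω))
          / (∑ i ∈ range N, gibbsWeight J lam (y i ω) / q (y i ω)) - gibbsExpect J lam f))
      atTop Yg (fun _ => P) P' := by
  have hw0 : ∀ φ, 0 < gibbsWeight J lam φ := fun φ => gibbsWeight_pos J lam φ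
  have hwm : Measurable (gibbsWeight J lam) := (continuous_gibbsWeight J lam).measurable
  have hwi : Integrable (gibbsWeight J lam) := integrable_gibbsWeight hlam J
  have hfw : Integrable (fun φ => f φ * gibbsWeight J lam φ) := by
    have h := polyObs_integrable_mul_mul_gibbsWeight one_pos (latticePhi4Action_coercive hlam J) hf
      (polyObs_const 1)
    exact h.congr (Eventually.of_forall fun φ => by simp only [mul_one])
  have h := flow_reweighting_clt (μ := volume) hw0 hwm hwi hq0 hqm hq1 hW₂ hf.1 hfw
    (by rw [← gibbsExpect_eq_div_integral]; exact hfb) hym hind hlaw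
    (Yg := Yg) (P' := P') (by rw [← gibbsExpect_eq_div_integral]; exact hY)
  rw [← gibbsExpect_eq_div_integral] at h
  exact h

/-- **THE UPPER PINNING FOR EVERY POLYNOMIAL OBSERVABLE OF LATTICE φ⁴**: `f ∈ PolyObs` with
`Var f > 0` (unnormalised `∫ (f − ⟨f⟩)² e^{−S} > 0`), `W₂ < ∞`, `(f − ⟨f⟩)² b e^{−S} ∈ L¹`:
`2 τ_int(f) Var(f) ≤ (2/ā)(σ²_RW(f) + Var(f)·W₂/Z²) − Var(f)`, where `Var(f) = (∫ (f − ⟨f⟩)² e^{−S})/Z`,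
`σ²_RW(f) = Z⁻² ∫ (f − ⟨f⟩)² b e^{−S}`, `ā = (∫ ρ e^{−S})/Z`. -/
theorem phi4Flow_chainVar_le_of_reweightVar_poly {lam : ℝ} (hlam : 0 < lam)
    (J : Fin (n + 1) → Fin (n + 1) → ℝ) {q : (Fin (n + 1) → ℝ) → ℝ} (hq0 : ∀ φ, 0 < q φ)
    (hqm : Measurable q) (hqi : Integrable q) (hq1 : ∫ φ, q φ = 1) {f : (Fin (n + 1) → ℝ) → ℝ}
    (hf : PolyObs f) (hP : 0 < ∫ φ, (f φ - gibbsExpect J lam f) ^ 2 * gibbsWeight J lam φ)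
    (hW₂ : Integrable (fun φ => gibbsWeight J lam φ / q φ * gibbsWeight J lam φ))
    (hgb : Integrable (fun φ => (f φ - gibbsExpect J lam f) ^ 2 * (gibbsWeight J lam φ / q φ)
      * gibbsWeight J lam φ)) :
    2 * tauInt (fun k => (∫ φ, (f φ - gibbsExpect J lam f)
        * ((imhOpPhi4 J lam q)^[k] (fun ψ => f ψ - gibbsExpect J lam f)) φ * gibbsWeight J lam φ)
        / ∫ φ, (f φ - gibbsExpect J lam f) ^ 2 * gibbsWeight J lam φ)
        * ((∫ φ, (f φ - gibbsExpect J lam f) ^ 2 * gibbsWeight J lam φ) / ∫ φ, gibbsWeight J lam φ)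
      ≤ 2 / ((∫ φ, (1 - rejCurve volume (gibbsWeight J lam) q (gibbsWeight J lam φ / q φ))
              * gibbsWeight J lam φ) / ∫ φ, gibbsWeight J lam φ)
          * ((∫ φ, (f φ - gibbsExpect J lam f) ^ 2 * (gibbsWeight J lam φ / q φ)
              * gibbsWeight J lam φ) / (∫ φ, gibbsWeight J lam φ) ^ 2
            + (∫ φ, (f φ - gibbsExpect J lam f) ^ 2 * gibbsWeight J lam φ) / (∫ φ, gibbsWeight J lam φ)
              * ((∫ φ, gibbsWeight J lam φ / q φ * gibbsWeight J lam φ) / (∫ φ, gibbsWeight J lam φ) ^ 2))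
        - (∫ φ, (f φ - gibbsExpect J lam f) ^ 2 * gibbsWeight J lam φ) / ∫ φ, gibbsWeight J lam φ := by
  obtain ⟨hgm, hg2⟩ := polyObs_sq_integrable hlam J (polyObs_sub_const hf (gibbsExpect J lam f))
  have hg0 := integral_polyObs_sub_gibbsExpect hlam J hf
  rw [imhOpPhi4_eq_imhOp]
  exact imhOp_chainVar_le_of_reweightVar_of_sq (μ := volume) (fun φ => gibbsWeight_pos J lam φ)
    (continuous_gibbsWeight J lam).measurable (integrable_gibbsWeight hlam J) hq0 hqm hqi hq1 hW₂ hgm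
    hg2 hg0 hP hgb

end Lattice

end Summit.Ventures.LatticeQCDFlow.Exactness
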